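import Summits.BirchSwinnertonDyer.BirchSwinnertonDyer.Theorems.AdditiveKolyvaginRoadKolyvaginPrimitiveOfLowerHalvesOverQ
import Summits.BirchSwinnertonDyer.BirchSwinnertonDyer.Theorems.AdditiveKolyvaginRoadLowerHalfDescentOfKato
import Summits.BirchSwinnertonDyer.Rank1Residual.AdditivePotMult.ModelFree
import Literature.NumberTheory.EllipticCurves.BSDpVariableChangeProofs
import Literature.NumberTheory.EllipticCurves.BSDInvariantsProofs
import HarnessLib

/-!
# Route `AdditiveKolyvaginRoad`: KOLYVAGIN'S CONJECTURE MOD `p` AT ONE ADDITIVE POTENTIALLY GOOD ♯ FRAME FROM THE LOWER HALVES OF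
# `BSD_p` OVER TWO AUXILIARY QUADRATIC FIELDS AND KATO — the over-`ℚ` landing of the base-change engines (card `inert-theta-refinement`:
# real quadratic `F`, `p` INERT; card `parahoric-ordinary-type-engine`: auxiliary imaginary `K″`) on the cruxes KS′ `LevelKolyvaginSystemsAdditive`
# (item stmt-BirchSwinnertonDyer-21396) and KPA′ `KolyvaginPrimitiveAdditive` (item 21400)
# (cell `pub/bsd-wall`, width seat `bsd-wall-akr-p2x-w3` g11; `--supports stmt-BirchSwinnertonDyer-21396`, helper)

THEOREMS ONLY (no definition, no named fact, no `sorry`); every half of `BSD_p` and every published input below is a HYPOTHESIS (named facts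
of the tree, displayed).  BSD is not proved by any of this; KS′ and KPA′ stay OPEN at `p² ∣ N`; Kolyvagin's conjecture is not asserted.

THE POINT.  Width seat akr-p2x-w5's landing socket `AdditiveKoly.exists_kolyvaginClass_ne_zero_of_lowerHalves` (p638284 §1) turns the two
LOWER (Eisenstein) halves of `BSD_p` over `ℚ` — for `E` (analytic rank `1`) and for the minimal models of its Heegner twist `E^{(d_K)}`
(analytic rank `0`) — into a non-zero mod-`p` Kolyvagin class at a ♯ frame, VERBATIM the conclusion of KPA′ and of the line's only stub
`stub_kolyvaginPrimitiveAboveBottom`.  The crux-ideation cards that run an Eisenstein engine over an AUXILIARY QUADRATIC FIELD — the newest,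
`Ideas/inert-theta-refinement.md` (real quadratic `F` with `p` INERT, where `V_pE|G_{ℚ_{p²}}` is trianguline and θ-refined finite-slope
tools exist), and `parahoric-ordinary-type-engine` (imaginary `K″`) — deliver instead the lower half of `BSD_p` OVER THAT FIELD.  The
one-sided Artin–Milne descent (akr-p2x-w4's `QuadraticDescent.missingLowerBoundAt_of_lowerBaseChange_of_missingUpperBoundAt_twist`) brings it
down to `ℚ` at the price of the Euler-system half of the PARTNER twist, which `…LowerHalfDescentOfKato.lean` (§3
`missingLowerBoundAt_of_lowerBaseChange_unitTwist_of_kato`) supplies from KATO 2004 Thm. 14.5 (3) with every image ∕ reduction binder of the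
partner discharged from the frame when `p` is UNRAMIFIED in the auxiliary field.  This file COMPOSES the three at ONE ♯ frame:

* §1 `missingLowerBoundAt_of_minimalModels` — bookkeeping: `Typed.MissingLowerBoundAt` agrees on two globally minimal `ℚ`-models of the
  same curve (`shaAn`, `#Ш` are invariants of minimal models; Literature `shaAn_variableChange_of_isGloballyMinimal`, `shaOrder_variableChange`),
  so ONE auxiliary package for ONE minimal model of `E^{(d_K)}` serves the socket's `hlowTw` (which quantifies over all of them);
  `exists_analyticSha_le_primary_of_missingLowerBoundOverCAt` — currency bridge: the tree's typed over-`K` lower half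
  `AdditivePotMult.MissingLowerBoundOverCAt V p` (`ord_p #Ш_an(V/K) ≤ ord_p #Ш(V/K)`, any `K`-model `V`) with `Ш(V/K)` finite gives the
  `Ш[p^∞]`-shape «`analyticSha V = q`, `ord_p q ≤ ord_p #Ш(V)[p^∞]`» consumed below and by `QuadraticDescent.*` (`analyticSha = shaAnOverC`
  definitionally) — so an engine stated in the cell's over-`K` vocabulary plugs in without re-typing.
* §2 `exists_kolyvaginClass_ne_zero_of_quadraticLowerHalves_of_kato` — ONE ♯ frame `(W, p, K, Dt, β, ι)` with `E` POTENTIALLY GOOD at the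
  additive `p ≥ 5` (`0 ≤ ord_p j`); TWO auxiliary packages: a quadratic field `K₁ = ℚ(θ₁)`, `θ₁² = c₁`, `ord_p c₁ = 0`, a minimal model `W₁`
  of `E^{(c₁)}` of analytic rank `0` with `p ∤ ∏ c_ℓ(W₁)` and a datum `D₁` (`p ∤ c_{D₁}`), a `K₁`-model `V₁` of `E_{K₁}` and the LOWER half
  of `BSD_p(V₁/K₁)`; and the same (`K₂, c₂, W₂, D₂, V₂`) for ONE minimal model `Wd₀` of the Heegner twist `E^{(d_K)}`.  With Gross–Zagier,
  Kolyvagin + his bound, GZK, modularity, McCallum Cor. 5.6 (divisibility half), Dokchitser–Dokchitser Thm. 2.3 and Kato Thm. 14.5 (3) as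
  named-fact binders: `∃ n d, KolSupp (IsKolyvaginPrime N E K p) n ∧ d.kolyvaginClass _ 1 ≠ 0`.
  WHY TWO FIELDS (not proved here, recorded for the planners): for `d_F` prime to `N d_K` the root numbers satisfy
  `w(E^{(d_F)})·w(E^{(d_K d_F)}) = χ_{d_F}(−N)·χ_{d_F}(−N d_K²)·w(E)·w(E^{(d_K)}) = −1`, so the two partners never both have analytic rank `0`
  over the same auxiliary field: the card's Friedberg–Hoffstein supply is needed twice, with opposite sign prescriptions.

What stays research is exactly the cards' engines (the two LOWER halves over `K₁`, `K₂`) and the supply of `(K_i, c_i)` with the sign ∕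
Tamagawa ∕ Manin side conditions; nothing else is needed to reach the crux at the potentially good frames.

References (locators only): [cite: Kato2004Asterisque, Thm. 14.5 (3) (p. 236), Prop. 14.16 (2) (p. 244), (12.5.2) (p. 222)]
[cite: DokchitserDokchitserAnnals2010, §2.1 Thm. 2.3] [cite: McCallumLMS1991, §5 Cor. 5.6 (p. 310), §4 Cor. 4.5]
[cite: JetchevSkinnerWan2017, §7.4.1, §7.4.3] [cite: Miller2011LMS, Def. 1.1 (arXiv:1010.2431 p. 3)] [cite: SilvermanAEC2009, VII.1 Prop. 1.3(b), X.5 Cor. 5.4].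
-/

-- single-conjunct summit: `Summit.BirchSwinnertonDyer.BirchSwinnertonDyer.…` repeats the name by design
set_option linter.dupNamespace false
set_option autoImplicit false

noncomputable section

open scoped Classical

namespace Summit.BirchSwinnertonDyer.BirchSwinnertonDyer.Theorems.AdditiveKoly

open WeierstrassCurve NumberField
  Literature.NumberTheory.EllipticCurves Literature.NumberTheory.EllipticCurves.ModularForms
  Literature.NumberTheory.EllipticCurves.Rank1Residual Literature.NumberTheory.EllipticCurves.Rank1Residual.Typed
  Summit.BirchSwinnertonDyer.Rank1Residual Summit.BirchSwinnertonDyer.Rank1Residual.Additive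
  Summit.BirchSwinnertonDyer.BirchSwinnertonDyer.Theses.AdditiveKolyvaginRoad

/-! ## §1 `Typed.MissingLowerBoundAt` on two globally minimal models of one curve -/

/-- **Miller's LOWER half `Typed.MissingLowerBoundAt` is the same on any two globally minimal `ℚ`-models of one curve.**  If `W₁ = C₁ • X`
and `W₂ = C₂ • X` are both globally minimal, then `W₂ = (C₂ C₁⁻¹) • W₁` with `#Ш_an(W₂) = #Ш_an(W₁)` (`shaAn_variableChange_of_isGloballyMinimal`:
the period changes by `|u| = 1`) and `#Ш(W₂) = #Ш(W₁)` (`shaOrder_variableChange`).  Bookkeeping; the same statement for the route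
`CyclotomicUntwist` is `PSRowModelInvariance.missingLowerBoundAt_smul_iff` (not imported: other cone).
[cite: Miller2011LMS, §1 and Def. 1.1 (arXiv:1010.2431 p. 3)] [cite: SilvermanAEC2009, VII.1 Prop. 1.3(b)] -/
theorem missingLowerBoundAt_of_minimalModels (X : WeierstrassCurve ℚ) [X.IsElliptic]
    (W₁ W₂ : WeierstrassCurve ℚ) [W₁.IsGloballyMinimal] [W₂.IsGloballyMinimal] (C₁ C₂ : VariableChange ℚ)
    (h₁ : C₁ • X = W₁) (h₂ : C₂ • X = W₂) (p : ℕ) (h : MissingLowerBoundAt W₁ p) : MissingLowerBoundAt W₂ p := by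
  subst h₁ h₂
  have e : (C₂ * C₁⁻¹) • (C₁ • X) = C₂ • X := by rw [smul_smul, inv_mul_cancel_right]
  haveI : ((C₂ * C₁⁻¹) • (C₁ • X)).IsGloballyMinimal := by rw [e]; infer_instance
  have hAn : shaAn ((C₂ * C₁⁻¹) • (C₁ • X)) = shaAn (C₁ • X) :=
    (C₁ • X).shaAn_variableChange_of_isGloballyMinimal (C₂ * C₁⁻¹)
  have hSha : ((C₂ * C₁⁻¹) • (C₁ • X)).shaOrder = (C₁ • X).shaOrder :=
    (C₁ • X).shaOrder_variableChange_holds (C₂ * C₁⁻¹)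
  rw [e] at hAn hSha
  obtain ⟨q, hq, hle⟩ := h
  exact ⟨q, by rw [hAn, hq], by rw [hSha]; exact hle⟩

/-- **Currency bridge.**  The cell's typed LOWER half of `BSD_p` over a number field `K` on a model `V`,
`AdditivePotMult.MissingLowerBoundOverCAt V p` («`#Ш_an(V/K) = q ∈ ℚ`, `ord_p q ≤ ord_p #Ш(V/K)`», Dokchitser–Dokchitser normalisation
`shaAnOverC`), together with finiteness of `Ш(V/K)`, gives the `Ш[p^∞]`-currency hypothesis `hKlow` ∕ `hlow₁` ∕ `hlow₂` of the quadratic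
descent files: `analyticSha V = q` with `ord_p q ≤ ord_p #Ш(V/K)[p^∞]` (`analyticSha V = shaAnOverC V` by definition;
`ord_p #Ш = ord_p #Ш[p^∞]` for finite `Ш`, `padicValNat_card_addPrimaryComponent`).  Bookkeeping.
[cite: DokchitserDokchitserAnnals2010, §2.1 Conj. 2.1 and Notation (arXiv p. 5)] [cite: Miller2011LMS, Def. 1.1 (arXiv:1010.2431 p. 3)] -/
theorem exists_analyticSha_le_primary_of_missingLowerBoundOverCAt {F : Type} [Field F] [NumberField F]
    (V : WeierstrassCurve F) (p : ℕ) [Fact p.Prime] (hfin : V.ShaFinite)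
    (h : AdditivePotMult.MissingLowerBoundOverCAt V p) :
    ∃ q : ℚ, analyticSha V = (q : ℂ) ∧
      padicValRat p q ≤ padicValNat p (Nat.card (AddCommGroup.primaryComponent V.sha p)) := by
  haveI : Finite V.sha := hfin
  obtain ⟨q, hq, hle⟩ := h
  refine ⟨q, hq, ?_⟩
  rwa [padicValNat_card_addPrimaryComponent (A := V.sha) p]

/-! ## §2 One potentially good ♯ frame: lower halves over two auxiliary quadratic fields + Kato force a non-zero Kolyvagin class -/

section Frame

-- `K : Type`: the tree's ring-class class field theory is universe `0` (as in the crux).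
variable (W : WeierstrassCurve ℚ) [W.IsElliptic] [W.IsGloballyMinimal] [NeZero (W.conductorNorm ℤ)]
  (p : ℕ) [hp : Fact p.Prime] (K : Type) [Field K] [NumberField K]
  (Dt : ModularParametrizationData W (W.conductorNorm ℤ)) (β : ℤ) (ι : K →+* ℂ)

/-- **KOLYVAGIN'S CONJECTURE MOD `p` AT ONE ADDITIVE POTENTIALLY GOOD ♯ FRAME FROM THE LOWER HALVES OF `BSD_p` OVER TWO AUXILIARY QUADRATIC
FIELDS AND KATO.**  Frame: `W/ℚ` globally minimal elliptic, non-CM, `p ≥ 5` additive and POTENTIALLY GOOD (`Addv W p`, `0 ≤ ord_p j`), `ρ̄_{E,p}`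
onto, `p ∤ ∏ c_ℓ(E)`, `ord_{s=1} L(E,s) = 1`; `K` imaginary quadratic, `d_K` odd `< −4`, Heegner hypothesis, `L(E^{(d_K)},1) ≠ 0`; `(Dt, β, ι)`
with `4N ∣ β² − d_K`, `p ∤ c(Dt)`.  PUBLISHED inputs as binders: Gross–Zagier `hGZ`, Kolyvagin `hKo` + his bound `hKoB`, GZK `hGZK`, modularity
`hmod`, McCallum Cor. 5.6 divisibility half `hMc`, Dokchitser–Dokchitser Thm. 2.3 `hDD`, Kato Thm. 14.5 (3) `hKato`.
PACKAGE 1 (for `E`): a quadratic field `K₁ = ℚ(θ₁)` (`θ₁² = c₁`, `θ₁ ∉ ℚ`) with `ord_p c₁ = 0` (`p` UNRAMIFIED in `K₁` — for the card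
`inert-theta-refinement` `K₁` is REAL with `p` INERT), a globally minimal model `W₁` of `E^{(c₁)}` of analytic rank `0` with `p ∤ ∏ c_ℓ(W₁)`
and a parametrisation datum `D₁`, `p ∤ c_{D₁}`; a `K₁`-model `V₁` of `E_{K₁}`; the LOWER half of `BSD_p` for `V₁` over `K₁`
(«`#Ш_an(V₁) = q₁ ∈ ℚ`, `ord_p q₁ ≤ ord_p #Ш(V₁)[p^∞]`» — the engine's output).  PACKAGE 2: the same data `(K₂, c₂, W₂, D₂, V₂)` and LOWER
half for ONE globally minimal model `Wd₀ = Cd₀ • E^{(d_K)}` of the Heegner twist.  CONCLUSION: some Kolyvagin–Heegner datum `d` at some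
Kolyvagin level `n` (square-free product of Zhang–Kolyvagin primes) has `d.kolyvaginClass _ 1 ≠ 0` in `H¹(K, E[p])` — the conclusion of KPA′
and of the line's stub `stub_kolyvaginPrimitiveAboveBottom` at this frame.  Proof: `…unitTwist_of_kato` gives `Typed.MissingLowerBoundAt W p`
from package 1 (the partner `W₁` is additive potentially good at `p` with `ρ̄` onto because `E` is and `ord_p c₁ = 0`); `Wd₀` is non-CM,
additive at `p`, of analytic rank `0` (`AdditiveKolyvaginKernel.twist_nonCM_addv_rankZero`), potentially good (`j(Wd₀) = j(E)`) with `ρ̄` onto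
(`surj_iff_of_model_twist`), so package 2 gives `Typed.MissingLowerBoundAt Wd₀ p`, transported to every minimal model of the twist by §1;
then `exists_kolyvaginClass_ne_zero_of_lowerHalves`.  CONDITIONAL on every binder; nothing is booked.
[cite: Kato2004Asterisque, Thm. 14.5 (3) (p. 236), (12.5.2) (p. 222)] [cite: DokchitserDokchitserAnnals2010, §2.1 Thm. 2.3]
[cite: McCallumLMS1991, §5 Cor. 5.6 (p. 310) and §4 Cor. 4.5] [cite: JetchevSkinnerWan2017, §7.4.1 (eq:gz for K′), §7.4.3]
[cite: Miller2011LMS, Def. 1.1] -/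
theorem exists_kolyvaginClass_ne_zero_of_quadraticLowerHalves_of_kato
    -- published inputs (named facts of the tree)
    (hGZ : gross_zagier (W.conductorNorm ℤ) W K) (hKo : kolyvagin (W.conductorNorm ℤ) W K)
    (hKoB : Kolyvagin1990_padicValNat_card_sha_le (W.conductorNorm ℤ) W K)
    (hGZK : rank_eq_analyticRank_of_analyticRank_le_one) (hmod : hasEntireLFunction_rat)
    (hMc : McCallum1991_padicValNat_card_sha_primary_add_le_of_globalDivisibility)
    (hDD : Milne1972.bsdQuotientP_baseChange_relQuadratic_anyModel)
    (hKato : Kato2004.rankZero_padicValNat_sha_le_of_additive_potGood_of_imageContainsSL2)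
    -- the frame (only the binders that are used), potentially good at `p`
    (hp5 : 5 ≤ p) (hadd : Addv W p) (hpot : 0 ≤ padicValRat p W.j) (hs : W.HasSurjectiveModNGaloisRep p)
    (hCM : ¬ W.HasCM) (htam : ¬ p ∣ W.tamagawaProduct) (hr : W.analyticRank = 1)
    (hK : IsImaginaryQuadratic K) (hodd : Odd (NumberField.discr K)) (hlt : NumberField.discr K < -4)
    (hH : SatisfiesHeegnerHypothesis (W.conductorNorm ℤ) K)
    (hL : (W.quadraticTwist (NumberField.discr K : ℚ)).entireLFunction 1 ≠ 0)
    (hβ : (4 * (W.conductorNorm ℤ : ℤ)) ∣ β ^ 2 - NumberField.discr K) (hc : ¬ (p : ℤ) ∣ Dt.c)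
    -- PACKAGE 1: an auxiliary quadratic field for `E`, a rank-zero partner twist, the LOWER half over the field
    (K₁ : Type) [Field K₁] [NumberField K₁] (h2₁ : Module.finrank ℚ K₁ = 2)
    {c₁ : ℚ} {θ₁ : K₁} (hθ₁ : θ₁ ^ 2 = algebraMap ℚ K₁ c₁) (hθ₁K : θ₁ ∉ Set.range (algebraMap ℚ K₁))
    (hc₁ : padicValRat p c₁ = 0)
    (W₁ : WeierstrassCurve ℚ) [W₁.IsElliptic] [W₁.IsGloballyMinimal]
    (hW₁ : ∃ C : VariableChange ℚ, C • W.quadraticTwist c₁ = W₁)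
    (hr₁ : W₁.analyticRank = 0) (htam₁ : ¬ p ∣ W₁.tamagawaProduct)
    {N₁ : ℕ} [NeZero N₁] (D₁ : ModularParametrizationData W₁ N₁) (hcD₁ : ¬ (p : ℤ) ∣ D₁.maninConstant)
    (V₁ : WeierstrassCurve K₁) [V₁.IsElliptic] (hV₁ : ∃ C : VariableChange K₁, C • W.baseChange K₁ = V₁)
    (hlow₁ : ∃ q₁ : ℚ, analyticSha V₁ = (q₁ : ℂ) ∧
      padicValRat p q₁ ≤ padicValNat p (Nat.card (AddCommGroup.primaryComponent V₁.sha p)))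
    -- PACKAGE 2: the same for ONE minimal model `Wd₀` of the Heegner twist `E^{(d_K)}`
    (Wd₀ : WeierstrassCurve ℚ) [Wd₀.IsElliptic] [Wd₀.IsGloballyMinimal] (Cd₀ : VariableChange ℚ)
    (hWd₀ : Cd₀ • W.quadraticTwist (NumberField.discr K : ℚ) = Wd₀)
    (K₂ : Type) [Field K₂] [NumberField K₂] (h2₂ : Module.finrank ℚ K₂ = 2)
    {c₂ : ℚ} {θ₂ : K₂} (hθ₂ : θ₂ ^ 2 = algebraMap ℚ K₂ c₂) (hθ₂K : θ₂ ∉ Set.range (algebraMap ℚ K₂))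
    (hc₂ : padicValRat p c₂ = 0)
    (W₂ : WeierstrassCurve ℚ) [W₂.IsElliptic] [W₂.IsGloballyMinimal]
    (hW₂ : ∃ C : VariableChange ℚ, C • Wd₀.quadraticTwist c₂ = W₂)
    (hr₂ : W₂.analyticRank = 0) (htam₂ : ¬ p ∣ W₂.tamagawaProduct)
    {N₂ : ℕ} [NeZero N₂] (D₂ : ModularParametrizationData W₂ N₂) (hcD₂ : ¬ (p : ℤ) ∣ D₂.maninConstant)
    (V₂ : WeierstrassCurve K₂) [V₂.IsElliptic] (hV₂ : ∃ C : VariableChange K₂, C • Wd₀.baseChange K₂ = V₂)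
    (hlow₂ : ∃ q₂ : ℚ, analyticSha V₂ = (q₂ : ℂ) ∧
      padicValRat p q₂ ≤ padicValNat p (Nat.card (AddCommGroup.primaryComponent V₂.sha p))) :
    ∃ (n : ℕ) (d : KolyvaginHeegnerData Dt β ι n),
      KolyvaginDescent.KolSupp (Zhang2014.IsKolyvaginPrime (W.conductorNorm ℤ) W K p) n ∧
        d.kolyvaginClass hp.out 1 ≠ 0 := by
  -- the LOWER half of `BSD_p(E)` over `ℚ` from PACKAGE 1
  have hlow : MissingLowerBoundAt W p :=
    QuadraticDescent.missingLowerBoundAt_of_lowerBaseChange_unitTwist_of_kato hDD hKato hGZK hmod W p hp5 hadd hpot hs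
      (by rw [hr]) K₁ h2₁ hθ₁ hθ₁K hc₁ W₁ hW₁ V₁ hV₁ hr₁ htam₁ D₁ hcD₁ hlow₁
  -- the minimal twist model `Wd₀`: non-CM, additive at `p`, analytic rank `0`, potentially good, `ρ̄` onto
  have hD0 : (NumberField.discr K : ℚ) ≠ 0 := by exact_mod_cast NumberField.discr_ne_zero K
  haveI hEt : (W.quadraticTwist (NumberField.discr K : ℚ)).IsElliptic := W.isElliptic_quadraticTwist hD0
  obtain ⟨-, hadd₀, hr₀⟩ :=
    AdditiveKolyvaginKernel.twist_nonCM_addv_rankZero hmod W p hCM hadd K hK hH hL Wd₀ Cd₀ hWd₀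
  have hs₀ : Wd₀.HasSurjectiveModNGaloisRep p := (surj_iff_of_model_twist W p hD0 ⟨Cd₀, hWd₀⟩).mpr hs
  have hpot₀ : 0 ≤ padicValRat p Wd₀.j := by
    rw [AdditivePotMult.j_of_model_twist (W := W) hD0 ⟨Cd₀, hWd₀⟩]; exact hpot
  -- the LOWER half of `BSD_p(E^{(d_K)})` over `ℚ` on `Wd₀` from PACKAGE 2, transported to every minimal model of the twist
  have hlow₀ : MissingLowerBoundAt Wd₀ p :=
    QuadraticDescent.missingLowerBoundAt_of_lowerBaseChange_unitTwist_of_kato hDD hKato hGZK hmod Wd₀ p hp5 hadd₀ hpot₀ hs₀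
      (by rw [hr₀]; exact zero_le_one) K₂ h2₂ hθ₂ hθ₂K hc₂ W₂ hW₂ V₂ hV₂ hr₂ htam₂ D₂ hcD₂ hlow₂
  have hlowTw : ∀ (Wd : WeierstrassCurve ℚ) [Wd.IsElliptic] [Wd.IsGloballyMinimal] (Cd : VariableChange ℚ),
      Cd • W.quadraticTwist (NumberField.discr K : ℚ) = Wd → MissingLowerBoundAt Wd p := fun Wd _ _ Cd hWd ↦
    missingLowerBoundAt_of_minimalModels (W.quadraticTwist (NumberField.discr K : ℚ)) Wd₀ Wd Cd₀ Cd hWd₀ hWd p hlow₀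
  -- the landing socket
  exact exists_kolyvaginClass_ne_zero_of_lowerHalves W p K Dt β ι hGZ hKo hKoB hGZK hmod hMc hp5 hadd hs hCM htam hr hK
    hodd hlt hH hL hβ hc hlow hlowTw

end Frame

end Summit.BirchSwinnertonDyer.BirchSwinnertonDyer.Theorems.AdditiveKoly

end
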